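import Summits.BirchSwinnertonDyer.BirchSwinnertonDyer.Theorems.ByReductionTypeAtTwoAdditiveKatoTransportNegTwoPrintExact
import Summits.BirchSwinnertonDyer.BirchSwinnertonDyer.Theorems.ByReductionTypeAtTwoMultOddBranchTwistFunctionalEquation
import HarnessLib

/-!
# Route ByReductionTypeAtTwo, crux `AdditivePotMultOverKAtTwo` (stmt-BirchSwinnertonDyer-22618; parent
# `AdditiveRankZeroAtTwo` 19098) — the (−2)-block twin of T20 (d) IN THE KERNEL, part 2: the two doors of the
# additive `(−2)`-split-twist block (key `γ⁻¹`, PRINT-EXACT home) with the functional-equation binder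
# `hLtι : (ι L̃) = (L̃)` REMOVED

Cell `bsd-2adic`, seat `bsd-2adic-t42` GEN 21 (AP3′). Sequel of `ByReductionTypeAtTwoMultOddBranchTwistFunctionalEquation`
(`MultOddBranchFE.map_invol_span_eq_of_eq_oddBranchMultTwist_two_of_split`: Mazur–Tate–Teitelbaum §I.17 for the
`ω·χ₂`-branch at a split multiplicative `2`, PROVED). HONEST FRAMING (D-0036 / D-0054): theorems only;
types-the-object-of; closes none; nothing booked; BSD is not proved by any of this. PARTITION: X5@2 additive,
C4″ 22618 (−2)-split-twist block × p = 2.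

Each door below is the addL2x GEN 16 door of the same name without `_fe` (p684511,
`…AdditiveKatoTransportNegTwoPrintExact`), with `hLtι` discharged — NO functional-equation hypothesis left:
* `lengthAt_selmerDualContra_le_of_oddBranchInputsNegTwoPrintExact_fe` (inputs: `Kato2004.thm12_4` PRINT, the
  typed input `KatoOddBranchInputsAtTwoNegTwoSplitTwistPrintExact`, `hXι : ι(char X') = char X'` T20 (a),
  `L̃ = 2^m L⁻₂ ≠ 0` with `L⁻₂ = padicLFunctionMinusBranchMultTwist f 1 1 (−1)`);
* `lengthAt_selmerDualContra_le_of_oddBranchInputsNegTwoPrintExact_of_lengthAt_symm_fe` (length form).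

References: [MazurTateTeitelbaum1986Invent] §I.17; [Kato2004Asterisque] Thm. 12.4, 12.5 (3), §17.13; [GreenbergLNM1716]
Thm. 1.14; memo `run/shared/lean/pub/bsd-2adic/t42/DESIGN-T42-ADDENDUM-25.md`.
-/

set_option autoImplicit false
-- the summit's namespace `Summit.BirchSwinnertonDyer.BirchSwinnertonDyer` (Sub = Summit) trips `dupNamespace`
set_option linter.dupNamespace false

noncomputable section

open scoped Classical MatrixGroups ModularForm NumberField

open Field CongruenceSubgroup PowerSeries WeierstrassCurve IsDedekindDomain
  Literature.NumberTheory.EllipticCurves Literature.NumberTheory.EllipticCurves.ModularForms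
  Literature.NumberTheory.EllipticCurves.Module

namespace Summit.BirchSwinnertonDyer.BirchSwinnertonDyer.Theorems.MultOddBranchFE

/-! ## The doors of the additive `(−2)`-split-twist block, functional equation discharged -/

section Door

/-- **Key-`γ⁻¹` PRINT-EXACT door of the (−2)-block (p684511) with the FE IN THE KERNEL**:
`AddKatoTwo.lengthAt_selmerDualContra_le_of_oddBranchInputsNegTwoPrintExact` with `hLtι` REMOVED (discharged by
`map_invol_span_eq_of_eq_oddBranchMultTwist_two_of_split`).
[cite: Kato2004Asterisque, Thm. 12.4 (2) (p. 221), Thm. 12.5 (3) and (12.5.1) (p. 222), §17.13 (pp. 279–280)]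
[cite: MazurTateTeitelbaum1986Invent, §I.17] -/
theorem lengthAt_selmerDualContra_le_of_oddBranchInputsNegTwoPrintExact_fe (h12 : Kato2004.thm12_4)
    (hPE : AddKatoTwo.KatoOddBranchInputsAtTwoNegTwoSplitTwistPrintExact)
    (W : WeierstrassCurve ℚ) [W.IsElliptic] [W.IsGloballyMinimal] [ContinuousSMul ℤ_[2] (W.tateModule 2)]
    {N : ℕ} [NeZero N] (f : CuspForm (Gamma0 N) 2) (κ : ZpExtension ℚ 2) (γ : absoluteGaloisGroup ℚ)
    (hsp : (W.quadraticTwist (-2)).HasSplitMultiplicativeReductionAtPrime 2)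
    (hirr : W.HasIrreducibleModPGaloisRep 2) (hκ : κ.IsCyclotomic) (hγ : κ.IsTopGenerator γ)
    (hγ' : IsCyclotomicVariable 2 γ) (hf : IsNewformOf (W.quadraticTwist (-2)) f)
    (I : Kato2004.IwasawaH1Data W 2 κ γ) (D' : W.SelmerDualData κ γ⁻¹) [Module.Finite (IwasawaAlgebra 2) D'.X]
    (hXι : (charIdeal (IwasawaAlgebra 2) D'.X).map (IwasawaAlgebra.invol 2).toRingHom =
      charIdeal (IwasawaAlgebra 2) D'.X)
    (Lt : IwasawaAlgebra 2) (m : ℕ)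
    (hLt : iwasawaToPowerSeries 2 Lt =
      PowerSeries.C ((2 : ℚ_[2]) ^ m) * padicLFunctionMinusBranchMultTwist f (1 : ℚ_[2]) 1 (-1))
    (hLt0 : Lt ≠ 0)
    (𝔮 : PrimeSpectrum (IwasawaAlgebra 2)) (h𝔮 : 𝔮.asIdeal.height = 1)
    (hp𝔮 : PowerSeries.C (2 : ℤ_[2]) ∉ 𝔮.asIdeal) :
    lengthAt (IwasawaAlgebra 2) D'.X 𝔮 ≤
      lengthAt (IwasawaAlgebra 2) (IwasawaAlgebra 2 ⧸ Ideal.span {Lt}) 𝔮 :=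
  AddKatoTwo.lengthAt_selmerDualContra_le_of_oddBranchInputsNegTwoPrintExact h12 hPE W f κ γ hsp hirr hκ hγ hγ'
    hf I D' hXι Lt m hLt hLt0 (map_invol_span_eq_of_eq_oddBranchMultTwist_two_of_split hsp hf hLt) 𝔮 h𝔮 hp𝔮

/-- **Key-`γ⁻¹` PRINT-EXACT door of the (−2)-block, LENGTH form (p684511), with the FE IN THE KERNEL**:
`AddKatoTwo.lengthAt_selmerDualContra_le_of_oddBranchInputsNegTwoPrintExact_of_lengthAt_symm` with `hLtι` REMOVED.
[cite: Kato2004Asterisque, Thm. 12.5 (3) and (12.5.1) (p. 222), §17.13 (pp. 279–280)] [cite: MazurTateTeitelbaum1986Invent, §I.17] -/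
theorem lengthAt_selmerDualContra_le_of_oddBranchInputsNegTwoPrintExact_of_lengthAt_symm_fe
    (h12 : Kato2004.thm12_4) (hPE : AddKatoTwo.KatoOddBranchInputsAtTwoNegTwoSplitTwistPrintExact)
    (W : WeierstrassCurve ℚ) [W.IsElliptic] [W.IsGloballyMinimal] [ContinuousSMul ℤ_[2] (W.tateModule 2)]
    {N : ℕ} [NeZero N] (f : CuspForm (Gamma0 N) 2) (κ : ZpExtension ℚ 2) (γ : absoluteGaloisGroup ℚ)
    (hsp : (W.quadraticTwist (-2)).HasSplitMultiplicativeReductionAtPrime 2)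
    (hirr : W.HasIrreducibleModPGaloisRep 2) (hκ : κ.IsCyclotomic) (hγ : κ.IsTopGenerator γ)
    (hγ' : IsCyclotomicVariable 2 γ) (hf : IsNewformOf (W.quadraticTwist (-2)) f)
    (I : Kato2004.IwasawaH1Data W 2 κ γ) (D' : W.SelmerDualData κ γ⁻¹)
    (Lt : IwasawaAlgebra 2) (m : ℕ)
    (hLt : iwasawaToPowerSeries 2 Lt =
      PowerSeries.C ((2 : ℚ_[2]) ^ m) * padicLFunctionMinusBranchMultTwist f (1 : ℚ_[2]) 1 (-1))
    (hLt0 : Lt ≠ 0)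
    (𝔮 : PrimeSpectrum (IwasawaAlgebra 2)) (h𝔮 : 𝔮.asIdeal.height = 1)
    (hp𝔮 : PowerSeries.C (2 : ℤ_[2]) ∉ 𝔮.asIdeal)
    (hXsym : lengthAt (IwasawaAlgebra 2) D'.X 𝔮 =
      lengthAt (IwasawaAlgebra 2) D'.X (PrimeSpectrum.comap (IwasawaAlgebra.invol 2).toRingHom 𝔮)) :
    lengthAt (IwasawaAlgebra 2) D'.X 𝔮 ≤
      lengthAt (IwasawaAlgebra 2) (IwasawaAlgebra 2 ⧸ Ideal.span {Lt}) 𝔮 :=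
  AddKatoTwo.lengthAt_selmerDualContra_le_of_oddBranchInputsNegTwoPrintExact_of_lengthAt_symm h12 hPE W f κ γ hsp
    hirr hκ hγ hγ' hf I D' Lt m hLt hLt0 (map_invol_span_eq_of_eq_oddBranchMultTwist_two_of_split hsp hf hLt)
    𝔮 h𝔮 hp𝔮 hXsym

end Door

end Summit.BirchSwinnertonDyer.BirchSwinnertonDyer.Theorems.MultOddBranchFE

end
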